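import Summits.QuantumAdvantage.AdviceFreeQNC0.GaugeCount
import HarnessLib

/-!
# Cell qa-qnc0 (rung F-Q2-odd, `p = 3`): the WIN event under the lifted gauge and window removal (ROUND-15 §3.1, §3.4)

Planner qa-qnc0-p1 g16, `ROUND-15.md` §3.1 (window removal) and §3.4 (payoff identity), for THEOREM A `BShotDWB3`.
With the gauge of `GaugeDefs.lean` at weight `κ₀ = 1`:

* `dk3_psi_nonInner` — for EVERY non-inner cut `k` (`k ≤ a` or `k ≥ a + W`) the stake `D_k` is invariant under the lift
  (the weight-`2` window word is the `m₂`-conjugate of the weight-`1` one: `trW_kappa_window`);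
* `WinOdd w x` — the win event of a bell vector (`#{k : w_k x = 1 ∧ D_k ≠ 1}` odd), `wtil` — the bells at inner cuts
  zeroed; `winOdd_wtil_psi` — `WIN_{w̃}(Ψ_r x) ↔ WIN_{w̃ ∘ Ψ_r}(x)`; `card_win_le_wtil` — window removal costs at most the
  patterns with a ringing inner bell; `exists_window` — among `Q = ⌊n/W⌋` disjoint windows one has
  `Q·#{x odd : some inner bell rings} ≤ B·2^{n+1}` when every odd pattern rings `≤ B` bells.

WHAT THIS IS NOT: the structured endgame for WIN and the accounting are the next files; separation NOT moved.
-/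

noncomputable section

namespace Summit.QuantumAdvantage.AdviceFreeQNC0

namespace DWalk

open Finset Equiv
open Literature.Computability.MetaComplexity Literature.Computability.MetaComplexity.Smolensky

section Win

variable {n : ℕ} {a L m : ℕ}

/-! ### Constant-weight windows: weight `κ` multiplies the translation -/

/-- On a window where `kappa k` is the constant `κc`, the translation is `κc` times the weight-`1` translation. -/
theorem trW_kappa_window {k : ℕ} {a W : ℕ} (κc : ZMod 3) (hκ : ∀ i, a ≤ i → i < a + W → kappa k i = κc)
    (x : ℕ → Bool) : trW (kappa k) x a W = κc * trW (fun _ => (1 : ZMod 3)) x a W := by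
  rw [trW_eq_sum, trW_eq_sum, Finset.mul_sum]
  refine Finset.sum_congr rfl fun i hi => ?_
  rw [hκ (a + i) (by omega) (by have := Finset.mem_range.1 hi; omega)]; ring

/-- `kappa 0` is the constant `1`. -/
theorem kappaConst_one (a L m : ℕ) : KappaConst a L m (1 : ZMod 3) 0 := by
  intro i _ _; unfold kappa; simp

/-- **The stake at every non-inner cut is a function of the outside bits and the weight-1 window word.** -/
theorem dk3_eq_of_out_Pwin_one {k : ℕ} (haW : a + (m + 1) * L ≤ n) (hk : k ≤ n)
    (hkni : k ≤ a ∨ a + (m + 1) * L ≤ k) {x x' : Fin (n + 1) → Bool}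
    (hout : ∀ i, ¬ (a ≤ i ∧ i < a + (m + 1) * L) → xN x i = xN x' i)
    (hP : Pwin a L m (1 : ZMod 3) x = Pwin a L m (1 : ZMod 3) x') : Dk3 x k = Dk3 x' k := by
  rw [dk3_eq_trW x hk, dk3_eq_trW x' hk, trW_window (kappa k) (xN x) haW, trW_window (kappa k) (xN x') haW]
  have h1 : trW (kappa k) (xN x) 0 a = trW (kappa k) (xN x') 0 a :=
    trW_congr fun t ht => ⟨rfl, by rw [Nat.zero_add]; exact hout t (by omega)⟩
  have h2 : sgnW (xN x) 0 a = sgnW (xN x') 0 a :=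
    sgnW_congr fun t ht => by rw [Nat.zero_add]; exact hout t (by omega)
  have h3 : trW (kappa k) (xN x) (a + (m + 1) * L) (n - (a + (m + 1) * L)) =
      trW (kappa k) (xN x') (a + (m + 1) * L) (n - (a + (m + 1) * L)) :=
    trW_congr fun t _ => ⟨rfl, hout _ (by omega)⟩
  -- weight-1 window data from the weight-1 window word
  have hE : sgnW (xN x) a ((m + 1) * L) = sgnW (xN x') a ((m + 1) * L) ∧
      trW (fun _ => (1 : ZMod 3)) (xN x) a ((m + 1) * L) = trW (fun _ => (1 : ZMod 3)) (xN x') a ((m + 1) * L) := by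
    have i1 := isAff_wp (kappa 0) (xN x) a ((m + 1) * L)
    have i2 := isAff_wp (kappa 0) (xN x') a ((m + 1) * L)
    rw [← Pwin_eq_wp (kappaConst_one a L m)] at i1 i2
    rw [hP] at i1
    have hu := i1.unique i2
    rw [trW_kappa_window 1 (kappaConst_one a L m) (xN x), trW_kappa_window 1 (kappaConst_one a L m) (xN x')] at hu
    exact ⟨hu.1, by simpa using hu.2⟩
  -- the actual weight on the window is a constant `κc ∈ {1, 2}`
  obtain ⟨κc, hκc⟩ : ∃ κc : ZMod 3, ∀ i, a ≤ i → i < a + (m + 1) * L → kappa k i = κc := by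
    rcases hkni with h | h
    · exact ⟨1, fun i hi _ => by unfold kappa; rw [if_neg (by omega)]⟩
    · exact ⟨2, fun i _ hi => by unfold kappa; rw [if_pos (by omega)]⟩
  rw [trW_kappa_window κc hκc (xN x), trW_kappa_window κc hκc (xN x'), h1, h2, h3, hE.1, hE.2]

/-- **`D_k` is invariant under the weight-1 lift for every non-inner cut.** -/
theorem dk3_psi_nonInner {k : ℕ} (haW : a + (m + 1) * L ≤ n) (hk : k ≤ n) (hkni : k ≤ a ∨ a + (m + 1) * L ≤ k)
    (r : Rand L m (1 : ZMod 3)) (x : Fin (n + 1) → Bool) : Dk3 (psi a L m 1 r x) k = Dk3 x k :=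
  dk3_eq_of_out_Pwin_one haW hk hkni (fun _ hi => xN_glue_of_not_mem x _ hi) (Pwin_psi haW r x)

/-! ### The win event, the trimmed bells -/

variable (a L m)

/-- WIN of a bell vector at `x`: an odd number of ringing bells at cuts with `D_k ≠ 1`. -/
abbrev WinOdd (w : Fin (n + 1) → CubeFn (ZMod 3) (n + 1)) (x : Fin (n + 1) → Bool) : Prop :=
  (univ.filter fun k : Fin (n + 1) => w k x = 1 ∧ Dk3 x k.val ≠ 1).card % 2 = 1

/-- Inner cuts of the window. -/
abbrev Inner (k : ℕ) : Prop := a < k ∧ k < a + (m + 1) * L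

/-- The trimmed bell vector: bells at inner cuts are switched off. -/
def wtil (w : Fin (n + 1) → CubeFn (ZMod 3) (n + 1)) (k : Fin (n + 1)) : CubeFn (ZMod 3) (n + 1) :=
  if Inner a L m k.val then 0 else w k

variable {a L m}

/-- Trimmed bells keep the degree bound. -/
theorem wtil_mem_lowDeg {w : Fin (n + 1) → CubeFn (ZMod 3) (n + 1)} {Δ : ℕ}
    (hw : ∀ k, w k ∈ lowDeg (ZMod 3) (n + 1) Δ) (k : Fin (n + 1)) : wtil a L m w k ∈ lowDeg (ZMod 3) (n + 1) Δ := by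
  unfold wtil; split_ifs
  · exact Submodule.zero_mem _
  · exact hw k

/-- A trimmed bell that rings is a non-inner bell of `w` that rings. -/
theorem wtil_eq_one_iff {w : Fin (n + 1) → CubeFn (ZMod 3) (n + 1)} {k : Fin (n + 1)} {x : Fin (n + 1) → Bool} :
    wtil a L m w k x = 1 ↔ ¬ Inner a L m k.val ∧ w k x = 1 := by
  unfold wtil
  split_ifs with h
  · simp only [Pi.zero_apply]
    constructor
    · intro h0; exact absurd h0 (by decide)
    · rintro ⟨hn, _⟩; exact absurd h hn
  · simp [h]

/-- **Payoff identity**: `WIN_{w̃}(Ψ_r x) ↔ WIN_{w̃ ∘ Ψ_r}(x)` (inner bells are off, non-inner stakes are invariant). -/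
theorem winOdd_wtil_psi (haW : a + (m + 1) * L ≤ n) (r : Rand L m (1 : ZMod 3))
    (w : Fin (n + 1) → CubeFn (ZMod 3) (n + 1)) (x : Fin (n + 1) → Bool) :
    WinOdd (wtil a L m w) (psi a L m 1 r x) ↔ WinOdd (fun k => fun y => wtil a L m w k (psi a L m 1 r y)) x := by
  unfold WinOdd
  have hset : (univ.filter fun k : Fin (n + 1) =>
      wtil a L m w k (psi a L m 1 r x) = 1 ∧ Dk3 (psi a L m 1 r x) k.val ≠ 1) =
      univ.filter fun k : Fin (n + 1) => wtil a L m w k (psi a L m 1 r x) = 1 ∧ Dk3 x k.val ≠ 1 := by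
    ext k
    simp only [mem_filter, mem_univ, true_and, wtil_eq_one_iff]
    constructor
    · rintro ⟨⟨hni, h1⟩, hD⟩
      exact ⟨⟨hni, h1⟩, by rwa [dk3_psi_nonInner haW (by have := k.isLt; omega) (by unfold Inner at hni; omega) r x] at hD⟩
    · rintro ⟨⟨hni, h1⟩, hD⟩
      exact ⟨⟨hni, h1⟩, by rwa [dk3_psi_nonInner haW (by have := k.isLt; omega) (by unfold Inner at hni; omega) r x]⟩
  rw [hset]

/-- **Window removal**: if no inner bell of `w` rings at `x`, then `w` and `w̃` win together. -/
theorem winOdd_wtil_iff_of_noInner {w : Fin (n + 1) → CubeFn (ZMod 3) (n + 1)} {x : Fin (n + 1) → Bool}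
    (h : ∀ k : Fin (n + 1), Inner a L m k.val → w k x ≠ 1) : WinOdd (wtil a L m w) x ↔ WinOdd w x := by
  unfold WinOdd
  have hset : (univ.filter fun k : Fin (n + 1) => wtil a L m w k x = 1 ∧ Dk3 x k.val ≠ 1) =
      univ.filter fun k : Fin (n + 1) => w k x = 1 ∧ Dk3 x k.val ≠ 1 := by
    ext k
    simp only [mem_filter, mem_univ, true_and, wtil_eq_one_iff]
    constructor
    · rintro ⟨⟨_, h1⟩, hD⟩; exact ⟨h1, hD⟩
    · rintro ⟨h1, hD⟩; exact ⟨⟨fun hi => h k hi h1, h1⟩, hD⟩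
  rw [hset]

/-- Hence `#{x odd : WIN_w} ≤ #{x odd : WIN_{w̃}} + #{x odd : some inner bell rings}`. -/
theorem card_win_le_wtil (w : Fin (n + 1) → CubeFn (ZMod 3) (n + 1)) :
    (univ.filter fun x : Fin (n + 1) → Bool =>
        (univ.filter fun j : Fin (n + 1) => x j = false).card % 2 = 1 ∧ WinOdd w x).card ≤
      (univ.filter fun x : Fin (n + 1) → Bool =>
        (univ.filter fun j : Fin (n + 1) => x j = false).card % 2 = 1 ∧ WinOdd (wtil a L m w) x).card +
      (univ.filter fun x : Fin (n + 1) → Bool =>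
        (univ.filter fun j : Fin (n + 1) => x j = false).card % 2 = 1 ∧
          ∃ k : Fin (n + 1), Inner a L m k.val ∧ w k x = 1).card := by
  refine le_trans (Finset.card_le_card fun x hx => ?_) (Finset.card_union_le _ _)
  rw [mem_filter] at hx
  rw [mem_union, mem_filter, mem_filter]
  by_cases hring : ∃ k : Fin (n + 1), Inner a L m k.val ∧ w k x = 1
  · exact Or.inr ⟨mem_univ _, hx.2.1, hring⟩
  · left
    refine ⟨mem_univ _, hx.2.1, ?_⟩
    have hring' : ∀ k : Fin (n + 1), Inner a L m k.val → w k x ≠ 1 := fun k hk h1 => hring ⟨k, hk, h1⟩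
    exact (winOdd_wtil_iff_of_noInner hring').2 hx.2.2

end Win

end DWalk

end Summit.QuantumAdvantage.AdviceFreeQNC0

end
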